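import Literature.AnabelianGeometry.SemiGraphs.TemperedMaximalCompactFalseOfEscaping
import Literature.AnabelianGeometry.SemiGraphs.TemperedEscapeOfHeights
import Literature.AnabelianGeometry.SemiGraphs.TreeSystemFixedPointTopological
import Literature.AnabelianGeometry.SemiGraphs.TemperedMaximalCompact
import Literature.AnabelianGeometry.SemiGraphs.TemperedVerticialDistinctSameVertex
import Literature.AnabelianGeometry.SemiGraphs.TemperedVerticialFixUnique
import HarnessLib

/-!
# An escaping compact subgroup is ITSELF maximal compact, once it is «edge-rigid» — the Zorn-free
# form of the (iv) seam ([SemiAnbd] Thm 3.7 (iv), p. 41)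

Mochizuki, *Semi-graphs of anabelioids*, Publ. RIMS **42** (2006), §3, Theorem 3.7 (iv), manuscript p. 41
[cite: MochizukiSemiAnbd2006, Thm 3.7(iv) p.41] ("the maximal compact subgroups of `π₁^temp(𝒢)` are
precisely the verticial subgroups"; the printed proof is for FINITE underlying semi-graphs, kernel
`maximalCompactIffVerticialAt_of_finiteGraph`), with Lemma 1.8 (ii)(a),(b) p. 20
[cite: MochizukiSemiAnbd2006, Lem. 1.8(ii) p.20] (a finite group acting on a tree fixes a vertex; a geodesic
with fixed endpoints is fixed pointwise).

PROOF-ONLY file (abc-iut cell, layer L3 frontier programme «REFUTE-F1732»,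
plan/L3/SUBDAG-SemiAnbd-Thm37iii-REFUTE.md, the (iv) clause of brick R7; seat abc-iut-w6-d063, W6 row
SemiAnbd:Thm3.7(iv); desk memo HOME/staging/w6/w6-d063/THM37iv-C-MAXIMAL-COMPACT.md; no definition, nothing
constructed).  Over abc-iut-L3-t10's `VerticialLevelData D` of a chart `c`, let `C` be a COMPACT subgroup
containing an element `g` whose fixed tree vertices escape to large height along the levels (the output of
abc-iut-L3-d4's `height_unbounded_of_criticalFree`, the situation of abc-iut-L3-d1's countermodel `𝒢_θ`).
Then EVERY compact `K ⊇ C` fixes, at every level and beyond every height bound `N`, a vertex of height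
`≥ N` together with an EDGE abutting to it (`exists_forall_mem_fixed_far_edge_of_heightEscape`: `K` fixes
a vertex `y` at level `j` by Lemma 1.8 (ii)(a); a `K`-fixed vertex of a deeper level, where the `g`-fixed
vertices are high, transported down by the transition map is a second `K`-fixed vertex `w ≠ y` of height
`≥ N`; the geodesic `[w, y]` is fixed pointwise, and its first half-edge at `w` gives the edge).  Hence, if
`C` is «EDGE-RIGID AT INFINITY» — every compact `K ⊇ C` fixing, at every level, edges abutting to fixed
vertices of arbitrarily large height lies in `C` (binder `hrigid`; at `𝒢_θ`: the stabilisers of the FAR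
level edges are cyclic of order `ord ρ_j(c)` — eventually constant along the ray, reviewer abc-iut-w5-d215
11:20:46Z — and `C = {g | ∀ j, ρ_j g ∈ ⟨ρ_j c⟩}`, a cardinality squeeze) — then `C` is itself a
MAXIMAL compact subgroup (`isMaximalCompactSubgroup_of_heightEscape_of_edgeRigid`), and since it is
escaping it lies in no verticial subgroup: `MaximalCompactIffVerticialAt 𝒢` and the ∀-countable named fact
`MaximalCompactIffVerticial` (F-1750) fail WITHOUT the Zorn input of
`not_maximalCompactIffVerticial_of_escaping_of_zorn`
(`not_maximalCompactIffVerticialAt_of_heightEscape_of_edgeRigid`,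
`not_maximalCompactIffVerticial_of_heightEscape_of_edgeRigid`).  (The Zorn route of record — abc-iut-w6-d120's
`ThetaRayEscapeMaximalCompact*.lean` with abc-iut-L3-t6's `hbd_galoisLevelData` — is itself binder-free at the
canonical tower; the present route adds that the escaping `C` is ITSELF the non-verticial maximal compact
subgroup.)  NEGATIVE-MODULO form: nothing is
asserted about any particular graph.

WHAT SURVIVES (last section): the converse implication «verticial ⇒ maximal compact» of Thm 3.7 (iv) holds
at EVERY Thm-3.7 graph, finite or not, with NO appeal to Thm 3.7 (iii): over level data whose level trees
are locally finite at vertices (binder `hlocfin`; at the canonical tower the half-edges at a vertex over `v`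
are cosets of a branch image in the finite level image of `Π_v`), a verticial subgroup lying in no edge-like
subgroup (binder `hVL`; total elevation) is maximal compact
(`isMaximalCompactSubgroup_of_mem_verticialSubgroups_of_locallyFinite`: if a compact `K ⊇ V` fixes the
compatible vertex system `x` of `V` (I1), then (I2) and Thm 3.7 (ii) (`verticialDistinct_holds`) give `K = V`;
otherwise `V` fixes, at every level, the edge of a half-edge at `x_j` (Lemma 1.8 (ii)(a),(b) and transport),
Kőnig (`SemiGraph.exists_compatible_of_finite`) makes these compatible, and (I3) puts `V` in an edge-like
subgroup); for GRAPHS of anabelioids `hVL` is the tree's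
`not_le_of_mem_verticialSubgroups_of_mem_edgeLikeSubgroups`
(`isMaximalCompactSubgroup_of_mem_verticialSubgroups_of_isGraph`).  So at `𝒢_θ` exactly ONE direction of
(iv) fails.  Nothing here bears on [IUTchIII] Cor. 3.12
(IUT uses finite dual semi-graphs only); no side taken.
-/

namespace Literature.AnabelianGeometry.SemiGraphs

namespace ProfiniteSemiGraph

namespace VerticialLevelData

open CategoryTheory

universe v u

variable {𝒢 : ProfiniteSemiGraph.{u}} {c : TemperedPiChart 𝒢} (D : VerticialLevelData.{v} 𝒢 c)

/-! ### Compact subgroups fix vertices; two fixed vertices give a fixed edge -/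

/-- A compact subgroup of `π₁^temp(𝒢)` fixes a vertex of every level tree ([SemiAnbd] Thm 3.7 (iii)
proof p. 41: "this action factors through a finite quotient … by Lemma 1.8 (ii)(a), `H` fixes at least one
… vertex"; the action is over `𝔾`, so no branch is switched). [cite: MochizukiSemiAnbd2006, Thm 3.7(iii) p.41] -/
theorem exists_forall_mem_fixed_vertex_of_isCompact (K : Subgroup c.G) (hK : IsCompact (K : Set c.G))
    (j : D.J) : ∃ y : (D.tree j).Vertex, ∀ k ∈ K, (D.act j k).hom.vertexMap y = y := by
  obtain ⟨y, hy⟩ := SemiGraph.exists_fixed_vertex_of_isCompact_over K hK (D.isTree j) (D.vertex j)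
    (D.proj j) (D.act j) (D.isOpen_ker j) (D.act_over j)
  exact ⟨y, fun k hk => hy ⟨k, hk⟩⟩

/-- The transition maps are over `𝔾`, pointwise on vertices. [cite: MochizukiSemiAnbd2006, Thm 3.7(iii) p.41] -/
theorem proj_vertexMap_trans ⦃i j : D.J⦄ (h : i ≤ j) (x : (D.tree j).Vertex) :
    (D.proj i).vertexMap ((D.trans h).vertexMap x) = (D.proj j).vertexMap x := by
  have e := congrArg (fun φ => SemiGraph.Hom.vertexMap φ x) (D.trans_over h)
  simpa only [SemiGraph.comp_vertexMap, Function.comp_apply] using e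

/-- **Lemma 1.8 (ii)(b) for a subgroup**: if every element of `K` fixes two DISTINCT vertices `y ≠ w` of a
level tree, then every element of `K` fixes a common EDGE (the edge of the first half-edge of the geodesic
from `y` to `w`, which is fixed pointwise). [cite: MochizukiSemiAnbd2006, Lem. 1.8(ii)(b) p.20] -/
theorem exists_forall_mem_fixed_edge_of_two_fixed_vertices (K : Subgroup c.G) (j : D.J)
    {y w : (D.tree j).Vertex} (hne : y ≠ w) (hy : ∀ k ∈ K, (D.act j k).hom.vertexMap y = y)
    (hw : ∀ k ∈ K, (D.act j k).hom.vertexMap w = w) :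
    ∃ b : (D.tree j).Branch, (D.tree j).abuts b = some y ∧
      ∀ k ∈ K, (D.act j k).hom.edgeMap ((D.tree j).edgeOf b) = (D.tree j).edgeOf b := by
  classical
  have hT := (D.isTree j).isTree
  -- the geodesic from `y` to `w` in the barycentric subdivision
  let p : (D.tree j).subdivision.Path (Sum.inl y) (Sum.inl w) :=
    (hT.connected (Sum.inl y) (Sum.inl w)).some.toPath
  -- it is fixed pointwise by every element of `K`
  have hall : ∀ k ∈ K, ∀ z ∈ p.1.support, SemiGraph.nodeMap (D.act j k) z = z := fun k hk =>
    SemiGraph.nodeMap_eq_self_of_isPath hT.isAcyclic (D.act j k) (by simp [hy k hk]) (by simp [hw k hk])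
      p.1 p.2
  -- its second node: adjacent to `Sum.inl y`, hence a branch-point abutting to `y`
  have key : ∀ (u u' : (D.tree j).Node) (q : (D.tree j).subdivision.Walk u u'), u ≠ u' →
      ∃ z ∈ q.support, (D.tree j).subdivision.Adj u z := by
    intro u u' q huu'
    cases q with
    | nil => exact absurd rfl huu'
    | cons h q' => exact ⟨_, by simp, h⟩
  obtain ⟨z, hz, hadj⟩ := key _ _ p.1 (fun h => hne (Sum.inl_injective h))
  change (SimpleGraph.fromRel (D.tree j).NodeRel).Adj _ _ at hadj
  rw [SimpleGraph.fromRel_adj] at hadj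
  obtain ⟨-, h | h⟩ := hadj
  · cases h
  · cases h
    rename_i b hb
    refine ⟨b, hb, fun k hk => ?_⟩
    have hfix : (D.act j k).hom.branchMap b = b := by
      have := hall k hk _ hz
      simpa only [SemiGraph.nodeMap_inr_inr, Sum.inr.injEq] using this
    rw [← (D.act j k).hom.edgeOf_branchMap b, hfix]

/-! ### Every compact subgroup containing a height-escaping element fixes edges at all levels -/

/-- **The second fixed vertex, far out.**  If `g ∈ K`, `K` compact, and the `g`-fixed tree vertices escape
to large height along the levels, then at every level `j` and for every bound `N` the elements of `K` fix a
common vertex `x` of height `≥ N` together with an EDGE abutting to it: a deep `K`-fixed vertex transported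
down is a `K`-fixed vertex of height `≥ N` exceeding that of the level-`j` fixed vertex `y`, hence `≠ y`,
and the geodesic from it to `y` is fixed pointwise. [cite: MochizukiSemiAnbd2006, Thm 3.7(iv) p.41] -/
theorem exists_forall_mem_fixed_far_edge_of_heightEscape (H : 𝒢.graph.Vertex → ℕ) (K : Subgroup c.G)
    (hK : IsCompact (K : Set c.G)) (g : c.G) (hg : g ∈ K)
    (hesc : ∀ N : ℕ, ∃ j : D.J, ∀ y : (D.tree j).Vertex, (D.act j g).hom.vertexMap y = y →
      N ≤ H ((D.proj j).vertexMap y))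
    (j : D.J) (N : ℕ) : ∃ (x : (D.tree j).Vertex) (b : (D.tree j).Branch),
      (D.tree j).abuts b = some x ∧ N ≤ H ((D.proj j).vertexMap x) ∧
      (∀ k ∈ K, (D.act j k).hom.vertexMap x = x) ∧
      ∀ k ∈ K, (D.act j k).hom.edgeMap ((D.tree j).edgeOf b) = (D.tree j).edgeOf b := by
  -- a `K`-fixed vertex at level `j`
  obtain ⟨y, hy⟩ := D.exists_forall_mem_fixed_vertex_of_isCompact K hK j
  -- a level beyond `N` and the height of `y`, and a common refinement
  obtain ⟨j₁, hj₁⟩ := hesc (max N (H ((D.proj j).vertexMap y) + 1))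
  obtain ⟨j₂, hjj₂, hj₁j₂⟩ := exists_ge_ge j j₁
  obtain ⟨y₂, hy₂⟩ := D.exists_forall_mem_fixed_vertex_of_isCompact K hK j₂
  -- the height of `y₂` is large (read at level `j₁`)
  have hgt : max N (H ((D.proj j).vertexMap y) + 1) ≤ H ((D.proj j₂).vertexMap y₂) := by
    have hfix₁ : (D.act j₁ g).hom.vertexMap ((D.trans hj₁j₂).vertexMap y₂) =
        (D.trans hj₁j₂).vertexMap y₂ := by
      rw [← D.trans_act_vertexMap, hy₂ g hg]
    have h1 := hj₁ _ hfix₁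
    rwa [D.proj_vertexMap_trans] at h1
  -- the transported vertex `w` at level `j` is `K`-fixed, of height `≥ N`, and `≠ y`
  set w : (D.tree j).Vertex := (D.trans hjj₂).vertexMap y₂ with hw_def
  have hw : ∀ k ∈ K, (D.act j k).hom.vertexMap w = w := fun k hk => by
    rw [hw_def, ← D.trans_act_vertexMap, hy₂ k hk]
  have hHw : H ((D.proj j).vertexMap w) = H ((D.proj j₂).vertexMap y₂) := by
    rw [hw_def, D.proj_vertexMap_trans]
  have hne : w ≠ y := by
    intro h
    have h' := congrArg (fun x => H ((D.proj j).vertexMap x)) h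
    simp only [hHw] at h'
    omega
  obtain ⟨b, hb, hfix⟩ := D.exists_forall_mem_fixed_edge_of_two_fixed_vertices K j hne hw hy
  exact ⟨w, b, hb, by rw [hHw]; omega, hw, hfix⟩

/-! ### Edge-rigid escaping compact subgroups are maximal compact -/

/-- **An edge-rigid compact subgroup containing a height-escaping element is MAXIMAL compact**
(Zorn-free).  Binder `hrigid` («every compact `K ⊇ C` fixing, at every level, edges at fixed vertices of
arbitrarily large height lies in `C`») is the model arithmetic: at `𝒢_θ` the stabilisers of the far level
edges are cyclic of order `ord ρ_j(c)` and `C = {g | ∀ j, ρ_j g ∈ ⟨ρ_j c⟩}`. [cite: MochizukiSemiAnbd2006, Thm 3.7(iv) p.41] -/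
theorem isMaximalCompactSubgroup_of_heightEscape_of_edgeRigid (H : 𝒢.graph.Vertex → ℕ)
    (C : Subgroup c.G) (hC : IsCompact (C : Set c.G)) (g : c.G) (hg : g ∈ C)
    (hesc : ∀ N : ℕ, ∃ j : D.J, ∀ y : (D.tree j).Vertex, (D.act j g).hom.vertexMap y = y →
      N ≤ H ((D.proj j).vertexMap y))
    (hrigid : ∀ K : Subgroup c.G, IsCompact (K : Set c.G) → C ≤ K →
      (∀ (j : D.J) (N : ℕ), ∃ (x : (D.tree j).Vertex) (b : (D.tree j).Branch),
        (D.tree j).abuts b = some x ∧ N ≤ H ((D.proj j).vertexMap x) ∧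
        (∀ k ∈ K, (D.act j k).hom.vertexMap x = x) ∧
        ∀ k ∈ K, (D.act j k).hom.edgeMap ((D.tree j).edgeOf b) = (D.tree j).edgeOf b) → K ≤ C) :
    IsMaximalCompactSubgroup C :=
  ⟨hC, fun K hK hCK => le_antisymm
    (hrigid K hK hCK fun j N => D.exists_forall_mem_fixed_far_edge_of_heightEscape H K hK g (hCK hg) hesc j N)
    hCK⟩

/-- The same with the height escape supplied by abc-iut-L3-d4's R6-level criterion «far fixed vertices + no
critical sub-joint» (`height_unbounded_of_criticalFree`; binders verbatim as there).
[cite: MochizukiSemiAnbd2006, Thm 3.7(iv) p.41] -/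
theorem isMaximalCompactSubgroup_of_criticalFree_of_edgeRigid (H : 𝒢.graph.Vertex → ℕ)
    (hstep : ∀ (b₁ b₂ : 𝒢.graph.Branch) (v₁ v₂ : 𝒢.graph.Vertex), b₁ ≠ b₂ →
      𝒢.graph.edgeOf b₁ = 𝒢.graph.edgeOf b₂ → 𝒢.graph.abuts b₁ = some v₁ → 𝒢.graph.abuts b₂ = some v₂ →
      H v₁ + 1 = H v₂ ∨ H v₂ + 1 = H v₁)
    (C : Subgroup c.G) (hC : IsCompact (C : Set c.G)) (g : c.G) (hg : g ∈ C)
    (hfar : ∀ (j : D.J) (n : ℕ), ∃ x : (D.tree j).Vertex,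
      n ≤ H ((D.proj j).vertexMap x) ∧ (D.act j g).hom.vertexMap x = x)
    (hcrit : ∀ n : ℕ, ∃ j₀ : D.J, ∀ j, j₀ ≤ j →
      ∀ (v : (D.tree j).Vertex) (b b' : (D.tree j).Branch),
        (D.tree j).abuts b = some v → (D.tree j).abuts b' = some v →
        H ((D.proj j).vertexMap v) = n + 1 →
        (D.act j g).hom.edgeMap ((D.tree j).edgeOf b) = (D.tree j).edgeOf b →
        (D.act j g).hom.edgeMap ((D.tree j).edgeOf b') = (D.tree j).edgeOf b' →
        (∃ (b₂ : (D.tree j).Branch) (v₂ : (D.tree j).Vertex), b₂ ≠ b ∧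
          (D.tree j).edgeOf b₂ = (D.tree j).edgeOf b ∧ (D.tree j).abuts b₂ = some v₂ ∧
          H ((D.proj j).vertexMap v₂) = n + 2) →
        (∃ (b₂ : (D.tree j).Branch) (v₂ : (D.tree j).Vertex), b₂ ≠ b' ∧
          (D.tree j).edgeOf b₂ = (D.tree j).edgeOf b' ∧ (D.tree j).abuts b₂ = some v₂ ∧
          H ((D.proj j).vertexMap v₂) = n) → False)
    (hrigid : ∀ K : Subgroup c.G, IsCompact (K : Set c.G) → C ≤ K →
      (∀ (j : D.J) (N : ℕ), ∃ (x : (D.tree j).Vertex) (b : (D.tree j).Branch),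
        (D.tree j).abuts b = some x ∧ N ≤ H ((D.proj j).vertexMap x) ∧
        (∀ k ∈ K, (D.act j k).hom.vertexMap x = x) ∧
        ∀ k ∈ K, (D.act j k).hom.edgeMap ((D.tree j).edgeOf b) = (D.tree j).edgeOf b) → K ≤ C) :
    IsMaximalCompactSubgroup C :=
  D.isMaximalCompactSubgroup_of_heightEscape_of_edgeRigid H C hC g hg
    (D.height_unbounded_of_criticalFree H hstep g hfar hcrit) hrigid

/-! ### The Zorn-free (iv) refutation seam -/

/-- **Zorn-free form of the (iv) seam**: an edge-rigid compact subgroup containing a height-escaping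
element is a maximal compact subgroup lying in NO verticial subgroup, so `MaximalCompactIffVerticialAt 𝒢`
fails at the chart `c` (∘ abc-iut-L3-t5's `not_maximalCompactIffVerticialAt_of_escaping` with `K := C` and
`escaping_of_height_unbounded`).  NEGATIVE-MODULO form. [cite: MochizukiSemiAnbd2006, Thm 3.7(iv) p.41] -/
theorem not_maximalCompactIffVerticialAt_of_heightEscape_of_edgeRigid (h37 : 𝒢.Thm37Hypotheses)
    (H : 𝒢.graph.Vertex → ℕ) (C : Subgroup c.G) (hC : IsCompact (C : Set c.G)) (g : c.G) (hg : g ∈ C)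
    (hesc : ∀ N : ℕ, ∃ j : D.J, ∀ y : (D.tree j).Vertex, (D.act j g).hom.vertexMap y = y →
      N ≤ H ((D.proj j).vertexMap y))
    (hrigid : ∀ K : Subgroup c.G, IsCompact (K : Set c.G) → C ≤ K →
      (∀ (j : D.J) (N : ℕ), ∃ (x : (D.tree j).Vertex) (b : (D.tree j).Branch),
        (D.tree j).abuts b = some x ∧ N ≤ H ((D.proj j).vertexMap x) ∧
        (∀ k ∈ K, (D.act j k).hom.vertexMap x = x) ∧
        ∀ k ∈ K, (D.act j k).hom.edgeMap ((D.tree j).edgeOf b) = (D.tree j).edgeOf b) → K ≤ C) :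
    ¬ MaximalCompactIffVerticialAt 𝒢 :=
  D.not_maximalCompactIffVerticialAt_of_escaping h37 C C
    (D.isMaximalCompactSubgroup_of_heightEscape_of_edgeRigid H C hC g hg hesc hrigid) le_rfl
    (D.escaping_of_height_unbounded C g hg H hesc)

/-- … and hence the ∀-countable named fact `MaximalCompactIffVerticial` (F-1750) fails, Zorn-free.
NEGATIVE-MODULO form: nothing is constructed here; finite graphs are settled positively by
`maximalCompactIffVerticialAt_of_finiteGraph`. [cite: MochizukiSemiAnbd2006, Thm 3.7(iv) p.41] -/
theorem not_maximalCompactIffVerticial_of_heightEscape_of_edgeRigid (h37 : 𝒢.Thm37Hypotheses)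
    (H : 𝒢.graph.Vertex → ℕ) (C : Subgroup c.G) (hC : IsCompact (C : Set c.G)) (g : c.G) (hg : g ∈ C)
    (hesc : ∀ N : ℕ, ∃ j : D.J, ∀ y : (D.tree j).Vertex, (D.act j g).hom.vertexMap y = y →
      N ≤ H ((D.proj j).vertexMap y))
    (hrigid : ∀ K : Subgroup c.G, IsCompact (K : Set c.G) → C ≤ K →
      (∀ (j : D.J) (N : ℕ), ∃ (x : (D.tree j).Vertex) (b : (D.tree j).Branch),
        (D.tree j).abuts b = some x ∧ N ≤ H ((D.proj j).vertexMap x) ∧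
        (∀ k ∈ K, (D.act j k).hom.vertexMap x = x) ∧
        ∀ k ∈ K, (D.act j k).hom.edgeMap ((D.tree j).edgeOf b) = (D.tree j).edgeOf b) → K ≤ C) :
    ¬ MaximalCompactIffVerticial.{u} := fun hMV =>
  D.not_maximalCompactIffVerticialAt_of_heightEscape_of_edgeRigid h37 H C hC g hg hesc hrigid
    (maximalCompactIffVerticial_iff_forall_at.mp hMV 𝒢)

/-! ### What survives of Thm 3.7 (iv): a verticial subgroup is maximal compact (model-free) -/

/-- `trans (le_refl j)` is the identity on branches. [cite: MochizukiSemiAnbd2006, Thm 3.7(iii) p.41] -/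
theorem trans_branchMap_refl (j : D.J) (b : (D.tree j).Branch) :
    (D.trans (le_refl j)).branchMap b = b := by
  rw [D.trans_id]; rfl

/-- Transition maps compose on branches. [cite: MochizukiSemiAnbd2006, Thm 3.7(iii) p.41] -/
theorem trans_branchMap_comp ⦃i j k : D.J⦄ (hij : i ≤ j) (hjk : j ≤ k) (b : (D.tree k).Branch) :
    (D.trans hij).branchMap ((D.trans hjk).branchMap b) = (D.trans (hij.trans hjk)).branchMap b := by
  rw [← D.trans_comp hij hjk, SemiGraph.comp_branchMap, Function.comp_apply]

/-- (I1)+(I2)+Thm 3.7 (ii): a compact subgroup containing a verticial subgroup `V` and fixing the compatible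
vertex system of `V` equals `V`. [cite: MochizukiSemiAnbd2006, Thm 3.7(iv) p.41] -/
theorem le_of_forall_fixed_compatible (h37 : 𝒢.Thm37Hypotheses) {v : 𝒢.graph.Vertex}
    {V K : Subgroup c.G} (hV : V ∈ verticialSubgroups c v) (hVK : V ≤ K)
    (x : ∀ j, (D.tree j).Vertex) (hxc : ∀ ⦃i j : D.J⦄ (h : i ≤ j), (D.trans h).vertexMap (x j) = x i)
    (hKx : ∀ j, ∀ k ∈ K, (D.act j k).hom.vertexMap (x j) = x j) : K ≤ V := by
  obtain ⟨v', H', hH', hstab⟩ := D.stab x hxc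
  have hKH : K ≤ H' := fun k hk => hstab k fun j => hKx j k hk
  have hVH : V = H' :=
    eq_of_le_of_mem_verticialSubgroups verticialDistinct_holds h37 c hV hH' (hVK.trans hKH)
  rw [hVH]
  exact hKH

/-- **What survives of Thm 3.7 (iv) at every Thm-3.7 graph: a verticial subgroup is a MAXIMAL compact
subgroup**, over level data with locally finite level trees, provided it lies in no edge-like subgroup
(model-free; binders `hlocfin`, `hVL` as in the module docstring). [cite: MochizukiSemiAnbd2006, Thm 3.7(iv) p.41] -/
theorem isMaximalCompactSubgroup_of_mem_verticialSubgroups_of_locallyFinite (h37 : 𝒢.Thm37Hypotheses)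
    {v : 𝒢.graph.Vertex} {V : Subgroup c.G} (hV : V ∈ verticialSubgroups c v)
    (hlocfin : ∀ (j : D.J) (x : (D.tree j).Vertex),
      {b : (D.tree j).Branch | (D.tree j).abuts b = some x}.Finite)
    (hVL : ∀ (e : 𝒢.graph.Edge) (L : Subgroup c.G), L ∈ edgeLikeSubgroups c e → ¬ V ≤ L) :
    IsMaximalCompactSubgroup V := by
  classical
  refine ⟨isCompact_of_mem_verticialSubgroups c hV, fun K hK hVK => ?_⟩
  -- (I1) the compatible `V`-fixed vertex system
  obtain ⟨x, hxc, hxV⟩ := D.fix v V hV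
  by_cases hKx : ∀ j, ∀ k ∈ K, (D.act j k).hom.vertexMap (x j) = x j
  · exact le_antisymm (D.le_of_forall_fixed_compatible h37 hV hVK x hxc hKx) hVK
  · exfalso
    push Not at hKx
    obtain ⟨j₀, k₀, hk₀, hmove⟩ := hKx
    -- at every level, a half-edge at `x j` whose edge is `V`-fixed
    have hS : ∀ j, ∃ b : (D.tree j).Branch, (D.tree j).abuts b = some (x j) ∧
        ∀ g ∈ V, (D.act j g).hom.edgeMap ((D.tree j).edgeOf b) = (D.tree j).edgeOf b := by
      intro j
      obtain ⟨j', hjj', hj₀j'⟩ := exists_ge_ge j j₀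
      -- at the deep level `j'`: `K` fixes some `y ≠ x j'`
      obtain ⟨y, hy⟩ := D.exists_forall_mem_fixed_vertex_of_isCompact K hK j'
      have hne : x j' ≠ y := by
        intro h
        have hfix' : (D.act j' k₀).hom.vertexMap (x j') = x j' := by rw [h]; exact hy k₀ hk₀
        apply hmove
        calc (D.act j₀ k₀).hom.vertexMap (x j₀)
            = (D.act j₀ k₀).hom.vertexMap ((D.trans hj₀j').vertexMap (x j')) := by rw [hxc hj₀j']
          _ = (D.trans hj₀j').vertexMap ((D.act j' k₀).hom.vertexMap (x j')) :=
              (D.trans_act_vertexMap hj₀j' k₀ (x j')).symm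
          _ = x j₀ := by rw [hfix', hxc hj₀j']
      obtain ⟨b', hb', hfixb'⟩ := D.exists_forall_mem_fixed_edge_of_two_fixed_vertices V j' hne
        (fun g hg => hxV g hg j') (fun g hg => hy g (hVK hg))
      -- transport the half-edge down to level `j`
      refine ⟨(D.trans hjj').branchMap b', ?_, fun g hg => ?_⟩
      · have h1 := (D.trans hjj').abuts_branchMap b' (x j') hb'
        rwa [hxc hjj'] at h1
      · rw [(D.trans hjj').edgeOf_branchMap, ← D.trans_act_edgeMap, hfixb' g hg]
    -- Kőnig: a compatible system of such half-edges
    obtain ⟨β, hβS, hβc⟩ := SemiGraph.exists_compatible_of_finite (X := fun j => (D.tree j).Branch)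
      (fun i j h b => (D.trans h).branchMap b) (fun j b => D.trans_branchMap_refl j b)
      (fun i j k hij hjk b => D.trans_branchMap_comp hij hjk b)
      (fun j => {b : (D.tree j).Branch | (D.tree j).abuts b = some (x j) ∧
        ∀ g ∈ V, (D.act j g).hom.edgeMap ((D.tree j).edgeOf b) = (D.tree j).edgeOf b})
      (fun j => (hlocfin j (x j)).subset fun b hb => hb.1)
      (fun j => by obtain ⟨b, hb⟩ := hS j; exact ⟨b, hb⟩)
      (by
        intro i j h b hb
        refine ⟨?_, fun g hg => ?_⟩
        · have h1 := (D.trans h).abuts_branchMap b (x j) hb.1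
          rwa [hxc h] at h1
        · rw [(D.trans h).edgeOf_branchMap, ← D.trans_act_edgeMap, hb.2 g hg])
    -- (I3): the stabiliser of the compatible edge system lies in an edge-like subgroup
    obtain ⟨j₁⟩ := D.nonempty
    obtain ⟨e, L, hL, -, hLstab⟩ := D.edge j₁ (fun j => (D.tree j.1).edgeOf (β j.1)) (by
      intro i j h
      rw [← (D.trans h).edgeOf_branchMap, hβc h])
    refine hVL e L hL fun g hg => hLstab g fun j => ⟨(hβS j.1).2 g hg, fun b hb => ?_⟩
    exact D.branchMap_eq_of_edgeMap_eq j.1 g b (by rw [hb]; exact (hβS j.1).2 g hg)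


/-- **Verticial ⇒ maximal compact, for GRAPHS of anabelioids** (every edge has two branches): the binder
`hVL` of the previous theorem is the tree's `not_le_of_mem_verticialSubgroups_of_mem_edgeLikeSubgroups`
(abc-iut-L3 lineage, `TemperedVerticialFixUnique.lean`), so only the local finiteness of the level trees
remains as an input. [cite: MochizukiSemiAnbd2006, Thm 3.7(iv) p.41] -/
theorem isMaximalCompactSubgroup_of_mem_verticialSubgroups_of_isGraph (h37 : 𝒢.Thm37Hypotheses)
    (hG : 𝒢.graph.IsGraph) {v : 𝒢.graph.Vertex} {V : Subgroup c.G} (hV : V ∈ verticialSubgroups c v)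
    (hlocfin : ∀ (j : D.J) (x : (D.tree j).Vertex),
      {b : (D.tree j).Branch | (D.tree j).abuts b = some x}.Finite) :
    IsMaximalCompactSubgroup V :=
  D.isMaximalCompactSubgroup_of_mem_verticialSubgroups_of_locallyFinite h37 hV hlocfin
    fun _ _ hL hVL => not_le_of_mem_verticialSubgroups_of_mem_edgeLikeSubgroups h37 hG c hV hL hVL

end VerticialLevelData

end ProfiniteSemiGraph

end Literature.AnabelianGeometry.SemiGraphs

-- tree-health (abc-iut-w6-d081 g4, 2026-08-26T14:39Z): comment-only re-land of a STRANDED ACCEPT of the gate-reload-#15p window (p442570 11:44Z, never served);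
-- evidence 14:35Z: re-lands filed OUTSIDE a reload window regain the farm olean in 10–20 min (ThetaRayRefutation 2nd re-land p451505). Declarations byte-identical.
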